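import Summits.Schanuel.Schanuel.Theses.RoyCriterion
import Literature.NumberTheory.Transcendental.PrasadRapinchukLengths
import Literature.NumberTheory.Transcendental.PeriodsWave0NesterenkoProofs
import Summits.Schanuel.Schanuel.Theorems.RoyThesisTyped.Negative.RankStructure

/-!
# Roy's criterion AT a point is Schanuel's inequality AT that point (pointwise transfer)

Crux `stmt-Schanuel-0463`: `Summit.Schanuel.Schanuel.Theses.RoyCriterion.RoyThesisTyped = ∀ n, RoyCriterion n`
(Roy 2001, Conjecture 2 for every rank), kernel-equivalent to Schanuel's conjecture
(`Literature.NumberTheory.Transcendental.Roy2001_iff_holds`, rank by rank).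

Roy's printed proof of `SchanuelRank l → RoyCriterion l` (§5, 1°; tree theorem
`royCriterion_of_schanuelRank`) passes from `y` to the dilated tuple `D • y` and therefore needs
Schanuel's inequality at `D • y`, not at `y`. This file records the POINTWISE form, which needs no
dilation and no linear independence: for a fixed `y : Fin l → ℂ`,

* `RoyThesisTyped.le_trdeg_of_royHypothesis` — if `c ≤ trdeg_ℚ ℚ(y, e^y)` then every Roy datum
  `α ∈ (ℂˣ)^l` satisfying `RoyHypothesis y α …` in an admissible window has `c ≤ trdeg_ℚ ℚ(y, α)`:
  Roy's Theorem 1 `(b) ⇒ (a)` (`royThm1BtoA_holds`) gives `α_j^{d_j} = e^{d_j y_j}`, so every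
  `e^{y_j}` is algebraic over `ℚ(y, α)` and `trdeg ℚ(y, e^y) ≤ trdeg ℚ(y, α)`;
* `RoyThesisTyped.royCriterionAt_iff_le_trdeg` — **Roy's Conjecture 2 AT `y` ⟺ Schanuel's
  inequality AT `y`** (the converse from the tree's unconditional auxiliary polynomials
  `royHypothesis_exp'` at `α = e^y`);
* `RoyThesisTyped.royCriterion_iff_pointwise` / `RoyThesisTyped.crux_iff_pointwise` — the rank-`l`
  rung and the crux rewritten through the pointwise equivalence.

Consequence for lines on this crux (line `SketchIdeator5R2`, idea `cm-tau-companion-rank-three`):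
every pointwise instance of the crux is exactly a pointwise instance of Schanuel's conjecture and
conversely, so a "sector" line proves the crux precisely where Schanuel is already a theorem.
No defs, no sorries, no named-fact hypotheses.
-/

set_option linter.dupNamespace false

noncomputable section

namespace Summit.Schanuel.Schanuel.Theorems

open Complex
open Literature.NumberTheory.Transcendental

/-- **Pointwise transfer (Schanuel at `y` ⇒ Roy at `y`).** For any `y : Fin l → ℂ` (no linear
independence needed) and any cardinal `c ≤ trdeg_ℚ ℚ(y, e^y)`: if `α j ≠ 0` for all `j` and
`RoyHypothesis y α s₀ s₁ t₀ t₁ u` holds in an admissible window, then `c ≤ trdeg_ℚ ℚ(y, α)`.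
Roy's Theorem 1 `(b) ⇒ (a)` (`royThm1BtoA_holds`, applied coordinatewise through
`royConditionB_of_royHypothesis`) gives `d_j ≥ 1` with `α_j^{d_j} = e^{d_j y_j}`; hence
`(e^{y_j})^{d_j} ∈ ℚ(y, α)`, every generator of `ℚ(y, e^y)` is algebraic over `ℚ(y, α)`, and
`trdeg ℚ(y, e^y) ≤ trdeg ℚ(y, α)` (`PrasadRapinchuk.trdeg_adjoin_le_of_isAlgebraic`).
[cite: Roy2001, Thm. 1 and §5 (1°)] -/
theorem RoyThesisTyped.le_trdeg_of_royHypothesis {l : ℕ} {y α : Fin l → ℂ} {c : Cardinal}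
    (hS : c ≤ Algebra.trdeg ℚ
      ↥(IntermediateField.adjoin ℚ (Set.range y ∪ Set.range (cexp ∘ y))))
    (hα : ∀ j, α j ≠ 0) {s₀ s₁ t₀ t₁ u : ℝ} (hadm : RoyAdmissible s₀ s₁ t₀ t₁ u)
    (hhyp : RoyHypothesis y α s₀ s₁ t₀ t₁ u) :
    c ≤ Algebra.trdeg ℚ ↥(IntermediateField.adjoin ℚ (Set.range y ∪ Set.range α)) := by
  set K : IntermediateField ℚ ℂ := IntermediateField.adjoin ℚ (Set.range y ∪ Set.range α) with hK
  refine hS.trans (PrasadRapinchuk.trdeg_adjoin_le_of_isAlgebraic K ?_)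
  rintro x (⟨j, rfl⟩ | ⟨j, rfl⟩)
  · exact isAlgebraic_algebraMap
      (⟨y j, IntermediateField.subset_adjoin ℚ _ (Or.inl ⟨j, rfl⟩)⟩ : K)
  · obtain ⟨d, hd1, hd⟩ := royThm1BtoA_holds (y j) (α j) (hα j) s₀ s₁ t₀ t₁ u hadm
      (royConditionB_of_royHypothesis hhyp j)
    have hαK : α j ∈ K := IntermediateField.subset_adjoin ℚ _ (Or.inr ⟨j, rfl⟩)
    have hmem : (cexp (y j)) ^ d ∈ K := by
      rw [← Complex.exp_nat_mul, ← hd]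
      exact pow_mem hαK d
    exact IsAlgebraic.of_pow hd1 (isAlgebraic_algebraMap (⟨_, hmem⟩ : K))

/-- **Roy's Conjecture 2 AT `y` ⟺ Schanuel's inequality AT `y`.** For every `y : Fin l → ℂ`:
(for all `α` with `α j ≠ 0` and every admissible window, `RoyHypothesis y α … → l ≤ trdeg ℚ(y, α)`)
holds iff `l ≤ trdeg_ℚ ℚ(y, e^y)`. `←` is `le_trdeg_of_royHypothesis`; `→` takes `α = e^y`
(never zero) in the admissible window `(1.3, 0.7, 1.2, 0.5, 1.32)` (`royAdmissible_example`), where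
the hypothesis holds unconditionally (`royHypothesis_exp'`, Roy 2001 §5, 2° with the tree's
auxiliary polynomials). A pointwise sharpening of `Roy2001_iff_holds`. [cite: Roy2001, §5] -/
theorem RoyThesisTyped.royCriterionAt_iff_le_trdeg {l : ℕ} (y : Fin l → ℂ) :
    (∀ α : Fin l → ℂ, (∀ j, α j ≠ 0) → ∀ (s₀ s₁ t₀ t₁ u : ℝ), RoyAdmissible s₀ s₁ t₀ t₁ u →
        RoyHypothesis y α s₀ s₁ t₀ t₁ u →
        (l : Cardinal) ≤ Algebra.trdeg ℚ
          ↥(IntermediateField.adjoin ℚ (Set.range y ∪ Set.range α))) ↔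
      (l : Cardinal) ≤ Algebra.trdeg ℚ
        ↥(IntermediateField.adjoin ℚ (Set.range y ∪ Set.range (cexp ∘ y))) := by
  constructor
  · intro h
    exact h (cexp ∘ y) (fun j => Complex.exp_ne_zero _) 1.3 0.7 1.2 0.5 1.32
      royAdmissible_example (royHypothesis_exp' y royAdmissible_example)
  · intro hS α hα s₀ s₁ t₀ t₁ u hadm hhyp
    exact RoyThesisTyped.le_trdeg_of_royHypothesis hS hα hadm hhyp

/-- **The rank-`l` rung, pointwise.** `RoyCriterion l` holds iff Schanuel's inequality
`l ≤ trdeg_ℚ ℚ(y, e^y)` holds at every `ℚ`-linearly independent `y : Fin l → ℂ` — i.e.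
`RoyCriterion l ↔ SchanuelRank l` re-derived through the pointwise equivalence
`royCriterionAt_iff_le_trdeg` (no dilation `D • y`). [cite: Roy2001, §1 and §5] -/
theorem RoyThesisTyped.royCriterion_iff_pointwise (l : ℕ) :
    RoyCriterion l ↔ ∀ y : Fin l → ℂ, LinearIndependent ℚ y →
      (l : Cardinal) ≤ Algebra.trdeg ℚ
        ↥(IntermediateField.adjoin ℚ (Set.range y ∪ Set.range (cexp ∘ y))) := by
  constructor
  · intro h y hy
    exact (RoyThesisTyped.royCriterionAt_iff_le_trdeg y).mp
      (fun α hα s₀ s₁ t₀ t₁ u hadm hhyp => h y α hy hα s₀ s₁ t₀ t₁ u hadm hhyp)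
  · intro h y α hy hα s₀ s₁ t₀ t₁ u hadm hhyp
    exact (RoyThesisTyped.royCriterionAt_iff_le_trdeg y).mpr (h y hy) α hα s₀ s₁ t₀ t₁ u hadm hhyp

/-- **The crux, pointwise.** `RoyThesisTyped` holds iff Schanuel's inequality holds at every
`ℚ`-linearly independent tuple of every rank — the crux's instances and Schanuel's instances
coincide point by point (so a line proving the crux on a set of tuples proves Schanuel's
conjecture on exactly that set, and vice versa). [cite: Roy2001, §1] -/
theorem RoyThesisTyped.crux_iff_pointwise :
    Summit.Schanuel.Schanuel.Theses.RoyCriterion.RoyThesisTyped ↔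
      ∀ (l : ℕ) (y : Fin l → ℂ), LinearIndependent ℚ y →
        (l : Cardinal) ≤ Algebra.trdeg ℚ
          ↥(IntermediateField.adjoin ℚ (Set.range y ∪ Set.range (cexp ∘ y))) :=
  forall_congr' RoyThesisTyped.royCriterion_iff_pointwise

end Summit.Schanuel.Schanuel.Theorems

end

/-!
## Appendix (appended 2026-08-16): the known loci of the crux, pointwise

By `RoyThesisTyped.le_trdeg_of_royHypothesis` every unconditional instance of Schanuel's
conjecture in the tree is at once an instance of the crux. Recorded here in the crux's own format:

* `RoyThesisTyped.royCriterion_on_algebraicStratum` — **every rank `l`** on the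
  Lindemann–Weierstrass stratum `y ∈ ℚ̄ˡ` (tree theorem `RoyThesisTyped.schanuelRank_of_isAlgebraic`,
  `Negative/RankStructure.lean`, from `algebraicIndependent_exp_holds`);
* `RoyThesisTyped.two_le_trdeg_of_pi` / `…_of_piSqrtThree`,
  `RoyThesisTyped.royCriterion_two_on_piPlanes` / `…_on_piSqrtThreePlanes` — **rank 2** on every
  `ℚ`-plane through `π` (resp. `π√3`), from Nesterenko (`nesterenko_holds`, `nesterenko'_holds`).

(Rank 3 on the CM–Gamma sector: `RoyCriterionRoyThesisTypedRankThreeCMGamma.lean`.) By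
`crux_iff_pointwise` the open content of the crux is exactly Schanuel's conjecture off these loci.
-/

noncomputable section

namespace Summit.Schanuel.Schanuel.Theorems

open Complex
open Literature.NumberTheory.Transcendental

/-! ### Every rank: the Lindemann–Weierstrass stratum -/

/-- **The crux on the `ℚ̄`-stratum, every rank.** For `y : Fin l → ℂ` `ℚ`-linearly independent
with ALGEBRAIC coordinates, every `α` with `α j ≠ 0`, every admissible window:
`RoyHypothesis y α … → l ≤ trdeg_ℚ ℚ(y, α)` — Lindemann–Weierstrass
(`RoyThesisTyped.schanuelRank_of_isAlgebraic`) through the pointwise transfer. This is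
`RoyCriterion l` restricted to `ℚ̄ˡ`, for every `l`. [cite: Roy2001, Thm. 1] [cite: BakerTNT1975, Ch. 1 Thm 1.4] -/
theorem RoyThesisTyped.royCriterion_on_algebraicStratum {l : ℕ} {y α : Fin l → ℂ}
    (hy : LinearIndependent ℚ y) (halg : ∀ j, IsAlgebraic ℚ (y j)) (hα : ∀ j, α j ≠ 0)
    {s₀ s₁ t₀ t₁ u : ℝ} (hadm : RoyAdmissible s₀ s₁ t₀ t₁ u)
    (hhyp : RoyHypothesis y α s₀ s₁ t₀ t₁ u) :
    (l : Cardinal) ≤ Algebra.trdeg ℚ ↥(IntermediateField.adjoin ℚ (Set.range y ∪ Set.range α)) :=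
  RoyThesisTyped.le_trdeg_of_royHypothesis
    (RoyThesisTyped.schanuelRank_of_isAlgebraic y halg hy) hα hadm hhyp

/-! ### Rank 2: the planes through `π` and `π√3` -/

/-- `π, e^π ∈ ℂ` are algebraically independent over `ℚ` (first two coordinates of Nesterenko's
triple, tree theorem `nesterenko_holds`). [cite: NesterenkoPhilippon2001, Ch. 3 Corollary 1.2] -/
theorem RoyThesisTyped.algebraicIndependent_pi_expPi :
    AlgebraicIndependent ℚ ![(Real.pi : ℂ), cexp Real.pi] := by
  have hN : AlgebraicIndependent ℚ ![Real.pi, Real.exp Real.pi, Real.Gamma (1 / 4)] :=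
    nesterenko_holds
  have h2 : AlgebraicIndependent ℚ ![Real.pi, Real.exp Real.pi] := by
    have h := hN.comp ![(0 : Fin 3), 1] (by decide)
    convert h using 1
    funext i; fin_cases i <;> rfl
  have e : (![(Real.pi : ℂ), cexp Real.pi] : Fin 2 → ℂ) =
      (Complex.ofRealAm.restrictScalars ℚ) ∘ ![Real.pi, Real.exp Real.pi] := by
    funext i; fin_cases i <;> simp [Complex.ofReal_exp]
  rw [e]
  exact h2.map' Complex.ofReal_injective

/-- `π, e^{π√3} ∈ ℂ` are algebraically independent over `ℚ` (first two coordinates of Nesterenko's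
second triple, tree theorem `nesterenko'_holds`). [cite: NesterenkoPhilippon2001, Ch. 1 §3 Corollary 3.2] -/
theorem RoyThesisTyped.algebraicIndependent_pi_expPiSqrtThree :
    AlgebraicIndependent ℚ ![(Real.pi : ℂ), cexp ((Real.pi * Real.sqrt 3 : ℝ) : ℂ)] := by
  have hN : AlgebraicIndependent ℚ
      ![Real.pi, Real.exp (Real.pi * Real.sqrt 3), Real.Gamma (1 / 3)] := nesterenko'_holds
  have h2 : AlgebraicIndependent ℚ ![Real.pi, Real.exp (Real.pi * Real.sqrt 3)] := by
    have h := hN.comp ![(0 : Fin 3), 1] (by decide)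
    convert h using 1
    funext i; fin_cases i <;> rfl
  have e : (![(Real.pi : ℂ), cexp ((Real.pi * Real.sqrt 3 : ℝ) : ℂ)] : Fin 2 → ℂ) =
      (Complex.ofRealAm.restrictScalars ℚ) ∘ ![Real.pi, Real.exp (Real.pi * Real.sqrt 3)] := by
    funext i; fin_cases i <;> simp [Complex.ofReal_exp]
  rw [e]
  exact h2.map' Complex.ofReal_injective

/-- **Schanuel(2) through `π`.** If `y i = π` then `2 ≤ trdeg_ℚ ℚ(y, e^y)` (the field contains
`π, e^π = e^{y i}`). [cite: NesterenkoPhilippon2001, Ch. 3 Corollary 1.2] -/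
theorem RoyThesisTyped.two_le_trdeg_of_pi {l : ℕ} (y : Fin l → ℂ) (i : Fin l)
    (hi : y i = Real.pi) :
    (2 : Cardinal) ≤ Algebra.trdeg ℚ
      ↥(IntermediateField.adjoin ℚ (Set.range y ∪ Set.range (cexp ∘ y))) := by
  set K : IntermediateField ℚ ℂ := IntermediateField.adjoin ℚ (Set.range y ∪ Set.range (cexp ∘ y))
    with hK
  have hK0 : (Real.pi : ℂ) ∈ K := by
    rw [← hi]; exact IntermediateField.subset_adjoin ℚ _ (Or.inl ⟨i, rfl⟩)
  have hK1 : cexp Real.pi ∈ K := by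
    rw [← hi]; exact IntermediateField.subset_adjoin ℚ _ (Or.inr ⟨i, rfl⟩)
  let f : Fin 2 → K := ![⟨_, hK0⟩, ⟨_, hK1⟩]
  have hf : AlgebraicIndependent ℚ f := by
    refine AlgebraicIndependent.of_comp K.val ?_
    convert RoyThesisTyped.algebraicIndependent_pi_expPi using 1
    funext k; fin_cases k <;> rfl
  simpa using hf.cardinalMk_le_trdeg

/-- **Schanuel(2) through `π√3`.** If `y i = π√3` then `2 ≤ trdeg_ℚ ℚ(y, e^y)`: `π` (`π² = (y i)²/3`)
and `e^{π√3} = e^{y i}` are algebraic over the field. [cite: NesterenkoPhilippon2001, Ch. 1 §3 Corollary 3.2] -/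
theorem RoyThesisTyped.two_le_trdeg_of_piSqrtThree {l : ℕ} (y : Fin l → ℂ) (i : Fin l)
    (hi : y i = ((Real.pi * Real.sqrt 3 : ℝ) : ℂ)) :
    (2 : Cardinal) ≤ Algebra.trdeg ℚ
      ↥(IntermediateField.adjoin ℚ (Set.range y ∪ Set.range (cexp ∘ y))) := by
  set K : IntermediateField ℚ ℂ := IntermediateField.adjoin ℚ (Set.range y ∪ Set.range (cexp ∘ y))
    with hK
  set x : Fin 2 → ℂ := ![(Real.pi : ℂ), cexp ((Real.pi * Real.sqrt 3 : ℝ) : ℂ)] with hx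
  have h2 : (2 : Cardinal) ≤ Algebra.trdeg ℚ ↥(IntermediateField.adjoin ℚ (Set.range x)) := by
    let f : Fin 2 → ↥(IntermediateField.adjoin ℚ (Set.range x)) :=
      fun k => ⟨x k, IntermediateField.subset_adjoin ℚ _ ⟨k, rfl⟩⟩
    have hf : AlgebraicIndependent ℚ f :=
      AlgebraicIndependent.of_comp (IntermediateField.adjoin ℚ (Set.range x)).val
        RoyThesisTyped.algebraicIndependent_pi_expPiSqrtThree
    simpa using hf.cardinalMk_le_trdeg
  refine h2.trans (PrasadRapinchuk.trdeg_adjoin_le_of_isAlgebraic K ?_)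
  have hyi : y i ∈ K := IntermediateField.subset_adjoin ℚ _ (Or.inl ⟨i, rfl⟩)
  rintro z ⟨k, rfl⟩
  fin_cases k
  · simp only [hx, Fin.zero_eta, Fin.isValue, Matrix.cons_val_zero]
    have hsq : ((Real.pi : ℂ)) ^ 2 = (y i) ^ 2 / 3 := by
      rw [hi, ← Complex.ofReal_pow, ← Complex.ofReal_pow, mul_pow,
        Real.sq_sqrt (by norm_num : (0 : ℝ) ≤ 3)]
      push_cast
      ring
    have hmem : ((Real.pi : ℂ)) ^ 2 ∈ K := by
      rw [hsq]
      exact div_mem (pow_mem hyi 2) (ofNat_mem K 3)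
    exact IsAlgebraic.of_pow (by norm_num : 0 < 2) (isAlgebraic_algebraMap (⟨_, hmem⟩ : K))
  · simp only [hx, Fin.mk_one, Fin.isValue, Matrix.cons_val_one, Matrix.cons_val_zero]
    have hmem : cexp ((Real.pi * Real.sqrt 3 : ℝ) : ℂ) ∈ K := by
      rw [← hi]
      exact IntermediateField.subset_adjoin ℚ _ (Or.inr ⟨i, rfl⟩)
    exact isAlgebraic_algebraMap (⟨_, hmem⟩ : K)

/-- **The crux's conclusion `2 ≤ trdeg ℚ(y, α)` through `π`** (any rank; for `l = 2` the rung
`RoyCriterion 2 = SchanuelTwo` at `y`). [cite: Roy2001, Thm. 1] [cite: NesterenkoPhilippon2001, Ch. 3 Corollary 1.2] -/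
theorem RoyThesisTyped.two_le_trdeg_of_royHypothesis_of_pi {l : ℕ} {y α : Fin l → ℂ} (i : Fin l)
    (hi : y i = Real.pi) (hα : ∀ j, α j ≠ 0) {s₀ s₁ t₀ t₁ u : ℝ}
    (hadm : RoyAdmissible s₀ s₁ t₀ t₁ u) (hhyp : RoyHypothesis y α s₀ s₁ t₀ t₁ u) :
    (2 : Cardinal) ≤ Algebra.trdeg ℚ ↥(IntermediateField.adjoin ℚ (Set.range y ∪ Set.range α)) :=
  RoyThesisTyped.le_trdeg_of_royHypothesis (RoyThesisTyped.two_le_trdeg_of_pi y i hi) hα hadm hhyp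

/-- **The crux's conclusion `2 ≤ trdeg ℚ(y, α)` through `π√3`.**
[cite: Roy2001, Thm. 1] [cite: NesterenkoPhilippon2001, Ch. 1 §3 Corollary 3.2] -/
theorem RoyThesisTyped.two_le_trdeg_of_royHypothesis_of_piSqrtThree {l : ℕ} {y α : Fin l → ℂ}
    (i : Fin l) (hi : y i = ((Real.pi * Real.sqrt 3 : ℝ) : ℂ)) (hα : ∀ j, α j ≠ 0)
    {s₀ s₁ t₀ t₁ u : ℝ} (hadm : RoyAdmissible s₀ s₁ t₀ t₁ u)
    (hhyp : RoyHypothesis y α s₀ s₁ t₀ t₁ u) :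
    (2 : Cardinal) ≤ Algebra.trdeg ℚ ↥(IntermediateField.adjoin ℚ (Set.range y ∪ Set.range α)) :=
  RoyThesisTyped.le_trdeg_of_royHypothesis (RoyThesisTyped.two_le_trdeg_of_piSqrtThree y i hi)
    hα hadm hhyp

/-- **`RoyCriterion 2` on every `ℚ`-plane through `π`, crux format** (no linear independence
needed): for `y : Fin 2 → ℂ` with a coordinate equal to `π`, every `α ∈ (ℂˣ)²`, every admissible
window, `RoyHypothesis y α … → 2 ≤ trdeg_ℚ ℚ(y, α)`. E.g. `y = (π, log 2)`, `(π, e)`, `(π, πβ)`.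
[cite: Roy2001, Conjecture 2] [cite: NesterenkoPhilippon2001, Ch. 3 Corollary 1.2] -/
theorem RoyThesisTyped.royCriterion_two_on_piPlanes :
    ∀ (y α : Fin 2 → ℂ), (∃ i, y i = Real.pi) → (∀ j, α j ≠ 0) →
      ∀ (s₀ s₁ t₀ t₁ u : ℝ), RoyAdmissible s₀ s₁ t₀ t₁ u → RoyHypothesis y α s₀ s₁ t₀ t₁ u →
        ((2 : ℕ) : Cardinal) ≤ Algebra.trdeg ℚ
          ↥(IntermediateField.adjoin ℚ (Set.range y ∪ Set.range α)) := by
  rintro y α ⟨i, hi⟩ hα s₀ s₁ t₀ t₁ u hadm hhyp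
  exact_mod_cast RoyThesisTyped.two_le_trdeg_of_royHypothesis_of_pi i hi hα hadm hhyp

/-- **`RoyCriterion 2` on every `ℚ`-plane through `π√3`, crux format.**
[cite: Roy2001, Conjecture 2] [cite: NesterenkoPhilippon2001, Ch. 1 §3 Corollary 3.2] -/
theorem RoyThesisTyped.royCriterion_two_on_piSqrtThreePlanes :
    ∀ (y α : Fin 2 → ℂ), (∃ i, y i = ((Real.pi * Real.sqrt 3 : ℝ) : ℂ)) → (∀ j, α j ≠ 0) →
      ∀ (s₀ s₁ t₀ t₁ u : ℝ), RoyAdmissible s₀ s₁ t₀ t₁ u → RoyHypothesis y α s₀ s₁ t₀ t₁ u →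
        ((2 : ℕ) : Cardinal) ≤ Algebra.trdeg ℚ
          ↥(IntermediateField.adjoin ℚ (Set.range y ∪ Set.range α)) := by
  rintro y α ⟨i, hi⟩ hα s₀ s₁ t₀ t₁ u hadm hhyp
  exact_mod_cast RoyThesisTyped.two_le_trdeg_of_royHypothesis_of_piSqrtThree i hi hα hadm hhyp

end Summit.Schanuel.Schanuel.Theorems

end
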